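import Literature.Probability.Process.BrownianBridgeToPoint3
import Mathlib.Geometry.Euclidean.Inversion.Basic
import Mathlib.Topology.MetricSpace.Closeds
import Mathlib.MeasureTheory.Constructions.BorelSpace.Basic
import HarnessLib

/-!
# The image of a compact subset of `ℝ³` under the unit inversion, as a measurable self-map of the
Hausdorff space

Topic `Literature/Probability/Process`; one definition with a junk branch and theorems, everything
PROVED (no named fact). The unit inversion `ι z = z/‖z‖²` (`EuclideanGeometry.inversion 0 1`,
with Mathlib's convention `ι 0 = 0`) is a homeomorphism of `ℝ³ ∖ {0}` but is not continuous at the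
pole, so `NonemptyCompacts.map ι` is unavailable and the image of a compact set through `0` need not
be compact. The push-forward of laws of random compact sets under `ι` — as in the support statement
`KelvinBridgeCovariance` (item `stmt-CriticalPhenomena-5033` of the route
`Summit.CriticalPhenomena.Ising3DConformalLimit.Theses.MoebiusRestrictionCurrents`: the law
`brownianBridgeToPointRangeLaw3 x y` of the range of Brownian motion from `x` conditioned to hit `y`
is mapped by `ι` to the law from `ιx` to `ιy`) — is therefore taken along

* `BrownianBridgeToPoint3.invImage K` — `ι '' K` if `0 ∉ K`, junk value `K` if `0 ∈ K`
  (a null event for laws of sets avoiding the pole);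

and this file supplies what `Measure.map`/`Measure.map_apply` need:

* `isOpen_setOf_zero_notMem` — `{K | 0 ∉ K}` is open in the Hausdorff space;
* `continuousOn_invImage` — `invImage` is continuous on `{K | 0 ∉ K}` (near `K₀ ∌ 0` all sets
  keep distance `≥ δ/2` from the pole, `δ = dist(0, K₀)`, where `ι` is `4/δ²`-Lipschitz since
  `‖ιa − ιb‖ = ‖a − b‖/(‖a‖‖b‖)`, `EuclideanGeometry.dist_inversion_inversion`);
* `measurable_invImage` — hence Borel measurable (`ContinuousOn.measurable_piecewise`);
* `invImage_invImage_of_notMem` — an involution on `{K | 0 ∉ K}`.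

## References

* I. Molchanov, *Theory of Random Sets*, Springer (2005), Chap. 1 §1.1 and App. C (random compact
  sets as random elements of the Hausdorff/Vietoris hyperspace; measurable set-transformations).
  [Molchanov2005]
-/

noncomputable section

open MeasureTheory TopologicalSpace Set Metric EuclideanGeometry
open scoped NNReal ENNReal Classical

namespace Literature.Probability.Process

namespace BrownianBridgeToPoint3

/-- The unit inversion `ι z = z / ‖z‖²` of `ℝ³` (`EuclideanGeometry.inversion 0 1`; `ι 0 = 0`).
[folklore] -/
abbrev unitInv : E3 → E3 := inversion (0 : E3) 1

/-- The unit inversion is continuous off the origin. [folklore] -/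
theorem continuousOn_unitInv : ContinuousOn unitInv ({0}ᶜ : Set E3) :=
  continuousOn_const.inversion continuousOn_const continuousOn_id fun _ h => h

/-- **The image of a nonempty compact set under the unit inversion**, as a self-map of the
Hausdorff space: `K ↦ ι '' K` when `0 ∉ K` (then `ι '' K` is compact, `ι` being continuous off
`0`), and the junk value `K` when `0 ∈ K` (the image of a compact set through the pole need not be
compact). [folklore] -/
def invImage (K : NonemptyCompacts E3) : NonemptyCompacts E3 :=
  if h : (0 : E3) ∉ (K : Set E3) then
    { carrier := unitInv '' (K : Set E3)
      isCompact' := K.isCompact.image_of_continuousOn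
        (continuousOn_unitInv.mono fun _ hz h0 => h (h0 ▸ hz))
      nonempty' := K.nonempty.image _ }
  else K

/-- The carrier of `invImage K` for `0 ∉ K`. [folklore] -/
theorem coe_invImage_of_notMem {K : NonemptyCompacts E3} (h : (0 : E3) ∉ (K : Set E3)) :
    (invImage K : Set E3) = unitInv '' (K : Set E3) := by
  rw [invImage, dif_pos h]
  rfl

/-- The junk value of `invImage K` for `0 ∈ K`. [folklore] -/
theorem invImage_of_mem {K : NonemptyCompacts E3} (h : (0 : E3) ∈ (K : Set E3)) :
    invImage K = K := by
  rw [invImage, dif_neg (not_not.2 h)]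

/-- `invImage` is an involution on `{K | 0 ∉ K}`. [folklore] -/
theorem invImage_invImage_of_notMem {K : NonemptyCompacts E3} (h : (0 : E3) ∉ (K : Set E3)) :
    invImage (invImage K) = K := by
  have h' : (0 : E3) ∉ (invImage K : Set E3) := by
    rw [coe_invImage_of_notMem h]
    rintro ⟨z, hz, hz0⟩
    have : z = 0 := by
      have := congrArg unitInv hz0
      rwa [show unitInv (unitInv z) = z from inversion_inversion (0 : E3) one_ne_zero z,
        show unitInv (0 : E3) = 0 from inversion_self (0 : E3) 1] at this
    exact h (this ▸ hz)
  apply NonemptyCompacts.ext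
  rw [coe_invImage_of_notMem h', coe_invImage_of_notMem h, image_image]
  convert image_id (K : Set E3) using 2
  exact inversion_inversion (0 : E3) one_ne_zero _

/-- `{K | 0 ∉ K}` is open in the Hausdorff space. [folklore] -/
theorem isOpen_setOf_zero_notMem : IsOpen {K : NonemptyCompacts E3 | (0 : E3) ∉ (K : Set E3)} := by
  have h : {K : NonemptyCompacts E3 | (0 : E3) ∉ (K : Set E3)}
      = (fun K : NonemptyCompacts E3 => infDist (0 : E3) (K : Set E3)) ⁻¹' {0}ᶜ := by
    ext K
    simp only [mem_setOf_eq, mem_preimage, mem_compl_iff, mem_singleton_iff]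
    rw [← mem_closure_iff_infDist_zero K.nonempty, K.isCompact.isClosed.closure_eq]
  rw [h]
  exact isOpen_compl_singleton.preimage (lipschitz_infDist_set (0 : E3)).continuous

/-- Points of a compact set at Hausdorff distance `< r` from `K₀` are within `r` of `K₀`.
[folklore] -/
theorem exists_dist_lt_of_dist_lt {K K₀ : NonemptyCompacts E3} {r : ℝ}
    (hK : dist K K₀ < r) {a : E3} (ha : a ∈ (K : Set E3)) :
    ∃ b ∈ (K₀ : Set E3), dist a b < r :=
  exists_dist_lt_of_hausdorffDist_lt ha (by rwa [NonemptyCompacts.dist_eq] at hK)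
    (hausdorffEDist_ne_top_of_nonempty_of_bounded K.nonempty K₀.nonempty
      K.isCompact.isBounded K₀.isCompact.isBounded)

/-- **`invImage` is continuous on the open set `{K | 0 ∉ K}`**: near `K₀ ∌ 0` all sets stay at
distance `≥ δ/2` from the pole (`δ = infDist 0 K₀ > 0`), where `ι` is `4/δ²`-Lipschitz
(`‖ιa − ιb‖ = ‖a − b‖/(‖a‖‖b‖)`). [folklore] -/
theorem continuousOn_invImage :
    ContinuousOn invImage {K : NonemptyCompacts E3 | (0 : E3) ∉ (K : Set E3)} := by
  intro K₀ hK₀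
  have hK₀' : (0 : E3) ∉ (K₀ : Set E3) := hK₀
  set δ : ℝ := infDist (0 : E3) (K₀ : Set E3) with hδ
  have hδpos : 0 < δ := (K₀.isCompact.isClosed.notMem_iff_infDist_pos K₀.nonempty).1 hK₀'
  -- norms on `K₀` are `≥ δ`
  have hnorm₀ : ∀ b ∈ (K₀ : Set E3), δ ≤ ‖b‖ := fun b hb => by
    have := infDist_le_dist_of_mem (x := (0 : E3)) hb
    rwa [dist_comm, dist_zero_right] at this
  rw [ContinuousWithinAt, Metric.tendsto_nhdsWithin_nhds]
  intro ε hε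
  refine ⟨min (δ / 2) (ε / 2 * (δ / 2 * δ)), lt_min (by positivity) (by positivity), ?_⟩
  intro K hK hdist
  have hK' : (0 : E3) ∉ (K : Set E3) := hK
  have hd1 : dist K K₀ < δ / 2 := lt_of_lt_of_le hdist (min_le_left _ _)
  have hd2 : dist K K₀ < ε / 2 * (δ / 2 * δ) := lt_of_lt_of_le hdist (min_le_right _ _)
  -- norms on `K` are `≥ δ/2`
  have hnorm : ∀ a ∈ (K : Set E3), δ / 2 ≤ ‖a‖ := fun a ha => by
    obtain ⟨b, hb, hab⟩ := exists_dist_lt_of_dist_lt hd1 ha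
    have h1 := norm_sub_norm_le b a
    rw [← dist_eq_norm, dist_comm] at h1
    linarith [hnorm₀ b hb]
  -- the Lipschitz estimate for a pair `a ∈ K`, `b ∈ K₀`
  have hlip : ∀ a ∈ (K : Set E3), ∀ b ∈ (K₀ : Set E3),
      dist (unitInv a) (unitInv b) ≤ dist a b / (δ / 2 * δ) := fun a ha b hb => by
    have ha0 : a ≠ 0 := fun h => by have := hnorm a ha; rw [h, norm_zero] at this; linarith
    have hb0 : b ≠ 0 := fun h => by have := hnorm₀ b hb; rw [h, norm_zero] at this; linarith
    have hd := dist_inversion_inversion (c := (0 : E3)) ha0 hb0 (1 : ℝ)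
    rw [dist_zero_right, dist_zero_right, one_pow] at hd
    rw [show unitInv a = inversion (0 : E3) 1 a from rfl,
      show unitInv b = inversion (0 : E3) 1 b from rfl, hd, div_mul_eq_mul_div, one_mul]
    exact div_le_div_of_nonneg_left dist_nonneg (by positivity)
      (mul_le_mul (hnorm a ha) (hnorm₀ b hb) hδpos.le (norm_nonneg _))
  -- Hausdorff distance of the images
  rw [NonemptyCompacts.dist_eq, coe_invImage_of_notMem hK', coe_invImage_of_notMem hK₀']
  refine lt_of_le_of_lt (hausdorffDist_le_of_mem_dist (by positivity : (0 : ℝ) ≤ ε / 2) ?_ ?_)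
    (by linarith)
  · rintro _ ⟨a, ha, rfl⟩
    obtain ⟨b, hb, hab⟩ := exists_dist_lt_of_dist_lt hd2 ha
    refine ⟨unitInv b, mem_image_of_mem _ hb, (hlip a ha b hb).trans ?_⟩
    rw [div_le_iff₀ (by positivity)]
    exact hab.le
  · rintro _ ⟨b, hb, rfl⟩
    have hd2' : dist K₀ K < ε / 2 * (δ / 2 * δ) := by rwa [dist_comm]
    obtain ⟨a, ha, hba⟩ := exists_dist_lt_of_dist_lt hd2' hb
    refine ⟨unitInv a, mem_image_of_mem _ ha, ?_⟩
    rw [dist_comm]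
    refine (hlip a ha b hb).trans ?_
    rw [div_le_iff₀ (by positivity), dist_comm]
    exact hba.le

/-- **`invImage` is Borel measurable** (continuous on the open set `{K | 0 ∉ K}`, the identity on
its complement). [folklore] -/
theorem measurable_invImage : Measurable invImage := by
  have hs : MeasurableSet {K : NonemptyCompacts E3 | (0 : E3) ∉ (K : Set E3)} :=
    isOpen_setOf_zero_notMem.measurableSet
  have hpw : invImage = {K : NonemptyCompacts E3 | (0 : E3) ∉ (K : Set E3)}.piecewise invImage id := by
    funext K
    by_cases hK : (0 : E3) ∉ (K : Set E3)
    · rw [piecewise_eq_of_mem _ _ _ hK]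
    · rw [piecewise_eq_of_notMem _ _ _ hK, id, invImage_of_mem (not_not.1 hK)]
  rw [hpw]
  exact continuousOn_invImage.measurable_piecewise continuous_id.continuousOn hs

end BrownianBridgeToPoint3

end Literature.Probability.Process
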